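import Mathlib

/-!
# Route StarvedNecks — crux `NecksCertify`, line `bargmann-small-late-exterior`: rung M2, helpers

Pointwise estimates for the no-parking rung `stub_noParkingDecay` (statement
`TonelliBargmann → CharacteristicCalculus → NoParkingDecay` of the line skeleton).  Everything
here is inequality bookkeeping for abstract functions `ψ, w, z, D, φ : ℝ → ℝ → ℝ` and a weight
`ν : ℝ → ℝ` subject to the hypotheses delivered by the two lower rungs (transport identities
along characteristics, slab/cylinder data facts, `|D| ≤ ν |ψ|` on the late exterior
`Ω = {T ≤ t} × {R₀ ≤ r}`):

* `exists_retardedSup`: the retarded-time supremum `N(u) = sup {|ψ(t,r)| : (t,r) ∈ Ω, u ≤ t − r}`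
  packaged with its working API (bound, nonnegativity, antitonicity, minimality);
* `integral_abs_source_le`: `∫ |D| ≤ K ∫ ν` along a curve in `Ω` on which `|ψ| ≤ K`;
* `w_estimate`: the incoming estimate `|w(t,r)| ≤ M ∫_{(r,∞)} ν + P ∫_{(r+L,∞)} ν` when
  `|ψ| ≤ M` at the source points `(t − s, r + s)`, `s ≤ min L (t − T)`, and `|ψ| ≤ P` on `Ω`;
* `outgoing_integral_le`, `phi_estimate`: the outgoing estimate `|φ(t,r)| ≤ ∫_{R₀}^{r} G` for an
  antitone nonnegative majorant `G(r − σ)` of `|w(t − σ, r − σ)|`;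
* `z_estimate`: `|z(t,r)| ≤ B + K ∫_{(R₀,∞)} ν` from the outgoing identity for `z`, the data
  facts `z = 0` (slab), `z = −w` (cylinder), and `|w| ≤ B`, `|ψ| ≤ K` along the outgoing ray.

Mathlib only; no named facts.
-/

noncomputable section

namespace Summit.FinalStateConjecture.FinalStateConjecture.Theorems.NecksCertifyBargmann.NoParking

open Filter Topology MeasureTheory Set Function
open scoped Topology

/-! ### The retarded-time supremum -/

/-- **Retarded-time supremum.**  For `ψ` with `|ψ| ≤ P` on `Ω = {T ≤ t, R₀ ≤ r}` there is a
function `N : ℝ → ℝ` (namely `N u = sSup {|ψ t r| : T ≤ t, R₀ ≤ r, u ≤ t - r}`) with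
`|ψ t r| ≤ N u` at every point of `Ω` of retarded time `t - r ≥ u`, `0 ≤ N`, `N` antitone, and
`N u ≤ B` whenever `B ≥ 0` bounds `|ψ|` on `Ω ∩ {u ≤ t - r}`.  (Registered as the sub-goal of this
helper file under the crux item; binder-free statement on purpose.) -/
theorem exists_retardedSup :
    ∀ (ψ : ℝ → ℝ → ℝ) (T R₀ P : ℝ), (∀ t r, T ≤ t → R₀ ≤ r → |ψ t r| ≤ P) →
    ∃ N : ℝ → ℝ, (∀ u t r, T ≤ t → R₀ ≤ r → u ≤ t - r → |ψ t r| ≤ N u) ∧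
      (∀ u, 0 ≤ N u) ∧ Antitone N ∧
      (∀ u B, 0 ≤ B → (∀ t r, T ≤ t → R₀ ≤ r → u ≤ t - r → |ψ t r| ≤ B) → N u ≤ B) := by
  intro ψ T R₀ P hP
  let S : ℝ → Set ℝ := fun u ↦
    (fun p : ℝ × ℝ ↦ |ψ p.1 p.2|) '' {p | T ≤ p.1 ∧ R₀ ≤ p.2 ∧ u ≤ p.1 - p.2}
  have hbdd : ∀ u, BddAbove (S u) := fun u ↦
    ⟨P, by rintro _ ⟨p, hp, rfl⟩; exact hP _ _ hp.1 hp.2.1⟩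
  have hle : ∀ u B, 0 ≤ B → (∀ t r, T ≤ t → R₀ ≤ r → u ≤ t - r → |ψ t r| ≤ B) →
      sSup (S u) ≤ B :=
    fun u B hB h ↦ Real.sSup_le (by rintro _ ⟨p, hp, rfl⟩; exact h _ _ hp.1 hp.2.1 hp.2.2) hB
  have hmem : ∀ u t r, T ≤ t → R₀ ≤ r → u ≤ t - r → |ψ t r| ≤ sSup (S u) :=
    fun u t r ht hr hu ↦ le_csSup (hbdd u) ⟨(t, r), ⟨ht, hr, hu⟩, rfl⟩
  have hnn : ∀ u, 0 ≤ sSup (S u) := fun u ↦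
    Real.sSup_nonneg (by rintro _ ⟨p, _, rfl⟩; exact abs_nonneg _)
  refine ⟨fun u ↦ sSup (S u), hmem, hnn, ?_, hle⟩
  intro u v huv
  exact hle v _ (hnn u) fun t r ht hr hv ↦ hmem u t r ht hr (huv.trans hv)

/-! ### Integrals along characteristics -/

/-- Restriction of a jointly continuous `F : ℝ → ℝ → ℝ` to a continuous curve
`s ↦ (f s, g s)` is continuous. -/
theorem continuous_along {F : ℝ → ℝ → ℝ} (hF : Continuous (uncurry F)) {f g : ℝ → ℝ}
    (hf : Continuous f) (hg : Continuous g) : Continuous fun s ↦ F (f s) (g s) :=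
  hF.comp (hf.prodMk hg)

/-- For `ν ≥ 0` on `[R₀, ∞)` and integrable on `(R₀, ∞)`: an interval piece `∫_{p}^{q} ν` with
`R₀ ≤ p' ≤ p ≤ q` is at most the tail `∫_{(p', ∞)} ν`. -/
theorem intervalIntegral_le_tail {R₀ : ℝ} {ν : ℝ → ℝ} (hνnn : ∀ s, R₀ ≤ s → 0 ≤ ν s)
    (hνint : IntegrableOn ν (Ioi R₀)) {p' p q : ℝ} (hp' : R₀ ≤ p') (hp : p' ≤ p)
    (hpq : p ≤ q) : ∫ s in p..q, ν s ≤ ∫ s in Ioi p', ν s := by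
  rw [intervalIntegral.integral_of_le hpq]
  exact setIntegral_mono_set (hνint.mono_set (Ioi_subset_Ioi hp'))
    (ae_restrict_of_forall_mem measurableSet_Ioi fun s (hs : p' < s) ↦ hνnn s (by linarith))
    (show Ioc p q ≤ Ioi p' from fun s hs ↦ lt_of_le_of_lt hp hs.1).eventuallyLE

/-- **Source integral along a curve in `Ω`.**  If `|D| ≤ ν |ψ|` on `Ω`, the curve
`s ↦ (f s, g s)`, `s ∈ [c, d]`, stays in `Ω`, and `|ψ| ≤ K` along it, then
`∫_c^d |D (f s) (g s)| ds ≤ K ∫_c^d ν (g s) ds`. -/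
theorem integral_abs_source_le {T R₀ : ℝ} {ν : ℝ → ℝ} {ψ D : ℝ → ℝ → ℝ}
    (hν : ContinuousOn ν (Ici R₀)) (hνnn : ∀ s, R₀ ≤ s → 0 ≤ ν s)
    (hDc : Continuous (uncurry D))
    (hDν : ∀ t r, T ≤ t → R₀ ≤ r → |D t r| ≤ ν r * |ψ t r|)
    {f g : ℝ → ℝ} (hf : Continuous f) (hg : Continuous g) {c d K : ℝ} (hcd : c ≤ d)
    (hΩ : ∀ s ∈ Icc c d, T ≤ f s ∧ R₀ ≤ g s) (hK : ∀ s ∈ Icc c d, |ψ (f s) (g s)| ≤ K) :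
    ∫ s in c..d, |D (f s) (g s)| ≤ K * ∫ s in c..d, ν (g s) := by
  have hνc : ContinuousOn (fun s ↦ ν (g s)) (uIcc c d) := by
    rw [uIcc_of_le hcd]
    exact hν.comp hg.continuousOn fun s hs ↦ (hΩ s hs).2
  rw [← intervalIntegral.integral_const_mul]
  refine intervalIntegral.integral_mono_on hcd
    ((continuous_along hDc hf hg).abs.intervalIntegrable _ _)
    (hνc.intervalIntegrable.const_mul K) fun s hs ↦ ?_
  calc |D (f s) (g s)| ≤ ν (g s) * |ψ (f s) (g s)| := hDν _ _ (hΩ s hs).1 (hΩ s hs).2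
    _ ≤ ν (g s) * K := mul_le_mul_of_nonneg_left (hK s hs) (hνnn _ (hΩ s hs).2)
    _ = K * ν (g s) := mul_comm _ _

/-! ### The incoming estimate for `w` -/

/-- **Incoming estimate.**  Let `w` satisfy the incoming transport identity with source `D`,
`|D| ≤ ν |ψ|` and `|ψ| ≤ P` on `Ω`, and `w = 0` on the slab `{t = T, r ≥ R₀}`.  If `(t, r) ∈ Ω`,
`L ≥ 0`, and `|ψ (t - s) (r + s)| ≤ M` for `0 ≤ s ≤ min L (t - T)` (the source points of retarded
time `≥ t - r - 2L`), then `|w t r| ≤ M ∫_{(r, ∞)} ν + P ∫_{(r + L, ∞)} ν`. -/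
theorem w_estimate {T R₀ P : ℝ} {ν : ℝ → ℝ} {ψ w D : ℝ → ℝ → ℝ}
    (hν : ContinuousOn ν (Ici R₀)) (hνnn : ∀ s, R₀ ≤ s → 0 ≤ ν s)
    (hνint : IntegrableOn ν (Ioi R₀))
    (hDc : Continuous (uncurry D))
    (hDν : ∀ t r, T ≤ t → R₀ ≤ r → |D t r| ≤ ν r * |ψ t r|)
    (hP : ∀ t r, T ≤ t → R₀ ≤ r → |ψ t r| ≤ P)
    (hin : ∀ t r a : ℝ, w t r = w (t - a) (r + a) + ∫ s in (0 : ℝ)..a, D (t - s) (r + s))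
    (hslab : ∀ r, R₀ ≤ r → w T r = 0)
    {t r L M : ℝ} (ht : T ≤ t) (hr : R₀ ≤ r) (hL : 0 ≤ L)
    (hM : ∀ s ∈ Icc 0 (min L (t - T)), |ψ (t - s) (r + s)| ≤ M) :
    |w t r| ≤ M * (∫ s in Ioi r, ν s) + P * ∫ s in Ioi (r + L), ν s := by
  obtain ⟨a, ha_def⟩ : ∃ a, a = t - T := ⟨_, rfl⟩
  obtain ⟨m, hm_def⟩ : ∃ m, m = min L (t - T) := ⟨_, rfl⟩
  rw [← hm_def] at hM
  have ha : 0 ≤ a := by rw [ha_def]; exact sub_nonneg.2 ht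
  have hm0 : 0 ≤ m := by rw [hm_def]; exact le_min hL (sub_nonneg.2 ht)
  have hma : m ≤ a := by rw [hm_def, ha_def]; exact min_le_right _ _
  have hf : Continuous fun s : ℝ ↦ t - s := continuous_const.sub continuous_id
  have hg : Continuous fun s : ℝ ↦ r + s := continuous_const.add continuous_id
  -- `w t r` as an incoming ray integral with foot on the slab
  have hw : w t r = ∫ s in (0:ℝ)..a, D (t - s) (r + s) := by
    have h := hin t r a
    rw [show t - a = T by rw [ha_def]; ring, hslab (r + a) (by linarith), zero_add] at h
    exact h
  have hP0 : 0 ≤ P := (abs_nonneg _).trans (hP t r ht hr)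
  have hI : 0 ≤ ∫ s in Ioi (r + L), ν s :=
    setIntegral_nonneg measurableSet_Ioi fun s (hs : r + L < s) ↦ hνnn s (by linarith)
  have hcont : Continuous fun s ↦ |D (t - s) (r + s)| := (continuous_along hDc hf hg).abs
  -- near sources: `s ≤ m`, `|ψ| ≤ M`
  have h1 : ∫ s in (0:ℝ)..m, |D (t - s) (r + s)| ≤ M * ∫ s in Ioi r, ν s := by
    have hM0 : 0 ≤ M := (abs_nonneg _).trans (hM 0 ⟨le_rfl, hm0⟩)
    calc ∫ s in (0:ℝ)..m, |D (t - s) (r + s)| ≤ M * ∫ s in (0:ℝ)..m, ν (r + s) :=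
          integral_abs_source_le hν hνnn hDc hDν hf hg hm0
            (fun s hs ↦ ⟨by linarith [hs.2], by linarith [hs.1]⟩) hM
      _ = M * ∫ s in r..(r + m), ν s := by
          rw [intervalIntegral.integral_comp_add_left, add_zero]
      _ ≤ M * ∫ s in Ioi r, ν s := by
          gcongr
          exact intervalIntegral_le_tail hνnn hνint hr le_rfl (by linarith)
  -- far sources: `m ≤ s ≤ a`, `|ψ| ≤ P` (empty when `t - T < L`)
  have h2 : ∫ s in m..a, |D (t - s) (r + s)| ≤ P * ∫ s in Ioi (r + L), ν s := by
    rcases le_or_gt L a with hLa | haL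
    · have hmL' : m = L := by rw [hm_def, ← ha_def]; exact min_eq_left hLa
      rw [hmL']
      calc ∫ s in L..a, |D (t - s) (r + s)| ≤ P * ∫ s in L..a, ν (r + s) :=
            integral_abs_source_le hν hνnn hDc hDν hf hg hLa
              (fun s hs ↦ ⟨by linarith [hs.2], by linarith [hs.1]⟩)
              (fun s hs ↦ hP _ _ (by linarith [hs.2]) (by linarith [hs.1]))
        _ = P * ∫ s in (r + L)..(r + a), ν s := by
            rw [intervalIntegral.integral_comp_add_left]
        _ ≤ P * ∫ s in Ioi (r + L), ν s := by
            gcongr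
            exact intervalIntegral_le_tail hνnn hνint (by linarith) le_rfl (by linarith)
    · have hma' : m = a := by rw [hm_def, ← ha_def]; exact min_eq_right haL.le
      rw [hma', intervalIntegral.integral_same]
      exact mul_nonneg hP0 hI
  calc |w t r| = |∫ s in (0:ℝ)..a, D (t - s) (r + s)| := by rw [hw]
    _ ≤ ∫ s in (0:ℝ)..a, |D (t - s) (r + s)| := intervalIntegral.abs_integral_le_integral_abs ha
    _ = (∫ s in (0:ℝ)..m, |D (t - s) (r + s)|) + ∫ s in m..a, |D (t - s) (r + s)| :=
        (intervalIntegral.integral_add_adjacent_intervals (hcont.intervalIntegrable _ _)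
          (hcont.intervalIntegrable _ _)).symm
    _ ≤ M * (∫ s in Ioi r, ν s) + P * ∫ s in Ioi (r + L), ν s := add_le_add h1 h2

/-! ### The outgoing estimates for `φ` and `z` -/

/-- **Outgoing ray integral against an antitone weight.**  If `F σ ≤ G (r - σ)` on `[0, a]`,
`0 ≤ a ≤ r - R₀`, and `G` is antitone and nonnegative on `[R₀, ∞)`, then
`∫_0^a F ≤ ∫_{R₀}^{r} G` (substitute `ρ = r - σ` and enlarge `[r - a, r]` to `[R₀, r]`). -/
theorem outgoing_integral_le {R₀ r a : ℝ} {F G : ℝ → ℝ}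
    (hF : IntervalIntegrable F volume 0 a) (ha : 0 ≤ a) (har : R₀ ≤ r - a)
    (hG : AntitoneOn G (Ici R₀)) (hGnn : ∀ ρ, R₀ ≤ ρ → 0 ≤ G ρ)
    (hFG : ∀ σ ∈ Icc 0 a, F σ ≤ G (r - σ)) :
    ∫ σ in (0:ℝ)..a, F σ ≤ ∫ ρ in R₀..r, G ρ := by
  have hmono : MonotoneOn (fun σ ↦ G (r - σ)) (uIcc 0 a) := by
    rw [uIcc_of_le ha]
    intro x hx y hy hxy
    exact hG (show R₀ ≤ r - y by linarith [hy.2]) (show R₀ ≤ r - x by linarith [hx.2])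
      (by linarith)
  calc ∫ σ in (0:ℝ)..a, F σ ≤ ∫ σ in (0:ℝ)..a, G (r - σ) :=
        intervalIntegral.integral_mono_on ha hF hmono.intervalIntegrable hFG
    _ = ∫ ρ in (r - a)..r, G ρ := by
        rw [intervalIntegral.integral_comp_sub_left, sub_zero]
    _ ≤ ∫ ρ in R₀..r, G ρ := by
        refine intervalIntegral.integral_mono_interval har (by linarith) le_rfl ?_ ?_
        · exact ae_restrict_of_forall_mem measurableSet_Ioc fun ρ hρ ↦ hGnn ρ hρ.1.le
        · apply AntitoneOn.intervalIntegrable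
          rw [uIcc_of_le (by linarith)]
          exact hG.mono Icc_subset_Ici_self

/-- **Outgoing estimate for `φ`.**  Let `φ` satisfy the outgoing transport identity with source
`w`, vanish on the slab `{t = T, r ≥ R₀}` and on the cylinder `{r = R₀, t ≥ T}`.  If `(t, r) ∈ Ω`
and `|w (t - σ) (r - σ)| ≤ G (r - σ)` for `0 ≤ σ ≤ min (t - T) (r - R₀)` with `G` antitone and
nonnegative on `[R₀, ∞)`, then `|φ t r| ≤ ∫_{R₀}^{r} G`. -/
theorem phi_estimate {T R₀ : ℝ} {φ w : ℝ → ℝ → ℝ} (hwc : Continuous (uncurry w))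
    (hout : ∀ t r a : ℝ, φ t r = φ (t - a) (r - a) + ∫ s in (0 : ℝ)..a, w (t - s) (r - s))
    (hslab : ∀ r, R₀ ≤ r → φ T r = 0) (hcyl : ∀ t, T ≤ t → φ t R₀ = 0)
    {t r : ℝ} (ht : T ≤ t) (hr : R₀ ≤ r) {G : ℝ → ℝ} (hG : AntitoneOn G (Ici R₀))
    (hGnn : ∀ ρ, R₀ ≤ ρ → 0 ≤ G ρ)
    (hwG : ∀ σ ∈ Icc 0 (min (t - T) (r - R₀)), |w (t - σ) (r - σ)| ≤ G (r - σ)) :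
    |φ t r| ≤ ∫ ρ in R₀..r, G ρ := by
  obtain ⟨a, ha_def⟩ : ∃ a, a = min (t - T) (r - R₀) := ⟨_, rfl⟩
  rw [← ha_def] at hwG
  have ha : 0 ≤ a := by rw [ha_def]; exact le_min (sub_nonneg.2 ht) (sub_nonneg.2 hr)
  have har : a ≤ r - R₀ := by rw [ha_def]; exact min_le_right _ _
  have hfoot : φ (t - a) (r - a) = 0 := by
    rcases le_total (t - T) (r - R₀) with h | h
    · have h1 : a = t - T := by rw [ha_def]; exact min_eq_left h
      rw [h1, show t - (t - T) = T by ring]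
      exact hslab _ (by linarith)
    · have h1 : a = r - R₀ := by rw [ha_def]; exact min_eq_right h
      rw [h1, show r - (r - R₀) = R₀ by ring]
      exact hcyl _ (by linarith)
  have hφ : φ t r = ∫ s in (0:ℝ)..a, w (t - s) (r - s) := by
    rw [hout t r a, hfoot, zero_add]
  have hf : Continuous fun s : ℝ ↦ t - s := continuous_const.sub continuous_id
  have hg : Continuous fun s : ℝ ↦ r - s := continuous_const.sub continuous_id
  calc |φ t r| = |∫ s in (0:ℝ)..a, w (t - s) (r - s)| := by rw [hφ]
    _ ≤ ∫ s in (0:ℝ)..a, |w (t - s) (r - s)| := intervalIntegral.abs_integral_le_integral_abs ha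
    _ ≤ ∫ ρ in R₀..r, G ρ :=
        outgoing_integral_le ((continuous_along hwc hf hg).abs.intervalIntegrable _ _) ha
          (by linarith) hG hGnn hwG

/-- **Outgoing estimate for `z`.**  Let `z` satisfy the outgoing transport identity with source
`D`, `|D| ≤ ν |ψ|` on `Ω`, `z = 0` on the slab and `z = -w` on the cylinder.  If `(t, r) ∈ Ω` and
along the outgoing ray `σ ∈ [0, min (t - T) (r - R₀)]` one has `|w (t - σ) (r - σ)| ≤ B` and
`|ψ (t - σ) (r - σ)| ≤ K`, then `|z t r| ≤ B + K ∫_{(R₀, ∞)} ν`. -/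
theorem z_estimate {T R₀ : ℝ} {ν : ℝ → ℝ} {ψ w z D : ℝ → ℝ → ℝ}
    (hν : ContinuousOn ν (Ici R₀)) (hνnn : ∀ s, R₀ ≤ s → 0 ≤ ν s)
    (hνint : IntegrableOn ν (Ioi R₀))
    (hDc : Continuous (uncurry D))
    (hDν : ∀ t r, T ≤ t → R₀ ≤ r → |D t r| ≤ ν r * |ψ t r|)
    (houtz : ∀ t r a : ℝ, z t r = z (t - a) (r - a) + ∫ s in (0 : ℝ)..a, D (t - s) (r - s))
    (hslab : ∀ r, R₀ ≤ r → z T r = 0) (hcyl : ∀ t, T ≤ t → z t R₀ = -w t R₀)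
    {t r B K : ℝ} (ht : T ≤ t) (hr : R₀ ≤ r)
    (hwB : ∀ σ ∈ Icc 0 (min (t - T) (r - R₀)), |w (t - σ) (r - σ)| ≤ B)
    (hψK : ∀ σ ∈ Icc 0 (min (t - T) (r - R₀)), |ψ (t - σ) (r - σ)| ≤ K) :
    |z t r| ≤ B + K * ∫ s in Ioi R₀, ν s := by
  obtain ⟨a, ha_def⟩ : ∃ a, a = min (t - T) (r - R₀) := ⟨_, rfl⟩
  rw [← ha_def] at hwB hψK
  have ha : 0 ≤ a := by rw [ha_def]; exact le_min (sub_nonneg.2 ht) (sub_nonneg.2 hr)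
  have hat : a ≤ t - T := by rw [ha_def]; exact min_le_left _ _
  have har : a ≤ r - R₀ := by rw [ha_def]; exact min_le_right _ _
  have hfoot : |z (t - a) (r - a)| ≤ B := by
    have hBa : |w (t - a) (r - a)| ≤ B := hwB a ⟨ha, le_rfl⟩
    rcases le_total (t - T) (r - R₀) with h | h
    · have h1 : a = t - T := by rw [ha_def]; exact min_eq_left h
      have h2 : z (t - a) (r - a) = 0 := by
        rw [h1, show t - (t - T) = T by ring]
        exact hslab _ (by linarith)
      rw [h2, abs_zero]
      exact (abs_nonneg _).trans hBa
    · have h1 : a = r - R₀ := by rw [ha_def]; exact min_eq_right h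
      have h2 : r - a = R₀ := by rw [h1]; ring
      rw [h2] at hBa ⊢
      rw [hcyl _ (by linarith), abs_neg]
      exact hBa
  have hf : Continuous fun s : ℝ ↦ t - s := continuous_const.sub continuous_id
  have hg : Continuous fun s : ℝ ↦ r - s := continuous_const.sub continuous_id
  have hsrc : |∫ s in (0:ℝ)..a, D (t - s) (r - s)| ≤ K * ∫ s in Ioi R₀, ν s := by
    calc |∫ s in (0:ℝ)..a, D (t - s) (r - s)| ≤ ∫ s in (0:ℝ)..a, |D (t - s) (r - s)| :=
          intervalIntegral.abs_integral_le_integral_abs ha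
      _ ≤ K * ∫ s in (0:ℝ)..a, ν (r - s) :=
          integral_abs_source_le hν hνnn hDc hDν hf hg ha
            (fun s hs ↦ ⟨by linarith [hs.2], by linarith [hs.2]⟩) hψK
      _ = K * ∫ s in (r - a)..r, ν s := by
          rw [intervalIntegral.integral_comp_sub_left, sub_zero]
      _ ≤ K * ∫ s in Ioi R₀, ν s := by
          have hK0 : 0 ≤ K := (abs_nonneg _).trans (hψK 0 ⟨le_rfl, ha⟩)
          gcongr
          exact intervalIntegral_le_tail hνnn hνint le_rfl (by linarith) (by linarith)
  calc |z t r| = |z (t - a) (r - a) + ∫ s in (0:ℝ)..a, D (t - s) (r - s)| := by rw [← houtz]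
    _ ≤ |z (t - a) (r - a)| + |∫ s in (0:ℝ)..a, D (t - s) (r - s)| := abs_add_le _ _
    _ ≤ B + K * ∫ s in Ioi R₀, ν s := add_le_add hfoot hsrc

end Summit.FinalStateConjecture.FinalStateConjecture.Theorems.NecksCertifyBargmann.NoParking
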